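import Summits.AnomalousDissipation.AnomalousDissipation.Theorems.SteadyMirrorGateTameMirrorLimitTG
import Summits.AnomalousDissipation.AnomalousDissipation.Theorems.MirrorVarietySteadyWeakIsGlobalLerayHopf
import Summits.AnomalousDissipation.AnomalousDissipation.Theorems.TaylorGreenLoudGalerkinStates.Negative.Anatomy

/-!
# SteadyMirrorGate — `_holds` links for the three PROVED binders of `closes`

The deciding theorem `closes (hC) (hG) (hN) (hT : TameMirrorLimitTG) (hL : SteadyWeakIsGlobalLerayHopf)
(hF : TaylorGreenForceRegularTG)` of `Theses/SteadyMirrorGate.lean` has three binders that are CLOSED on the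
ledger (stmt-AnomalousDissipation-33833 `TameMirrorLimitTG`, -33834 `SteadyWeakIsGlobalLerayHopf`,
-24257 `TaylorGreenForceRegularTG`), proved in modules that import the route file, so the gate could only record
them by comment («its module imports this route file, so no `_holds` link can be stated here»).
`HarnessLib.Audit.Tribunal.holdsProved` recognises a proved binder ONLY through a theorem named
`<Decl>_holds` / `<Decl>.holds` in the binder's namespace; without it the kernel tribunal (D-0034 t0) treats the
three binders as ATTACKED cruxes (roles in the rev-0 record: `t1c:timeout:TameMirrorLimitTG`,
`t1c:timeout:SteadyWeakIsGlobalLerayHopf`, `t1c:timeout:TaylorGreenForceRegularTG`) and, in tier full,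
`intro h; exact?` closes `H → <binder>` for every registered strong hypothesis `H`, manufacturing the spurious
eligibility blockers `unbridged-hypothesis:EnsembleZerothLaw | BrueDeLellisQuestion22 | BrueDeLellisQuestion21`
(the KolmogorovPincer precedent: `Theorems/KolmogorovPincerHoldsLinks.lean`, decomp-ad lens-1 g64 finding H).
These three aliases (no new mathematics) make the binders role "proved". Imports are the minimal proving
modules (route-independent apart from `Theses.SteadyMirrorGate` itself and the dormant `Theses.MirrorVariety`
behind `steadyWeakIsGlobalLerayHopf_proof`). Proposal target:
`Summits/AnomalousDissipation/AnomalousDissipation/Theorems/SteadyMirrorGateHoldsLinks.lean`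
(prefix `SteadyMirrorGate` ⇒ auto-imported by `harness/cli/tribunal check` for this route). decomp-ad lens-6 g62.

Landing note (decomp-ad census g21, p831147 bounce `dedup.landed`): the gate's duplicate scan keys on the signature TEXT, so
`theorem TameMirrorLimitTG_holds : TameMirrorLimitTG` collided with the landed `Theorems.steadyMirrorGate_tameMirrorLimitTG_holds`
(same proposition, wrong name for `holdsProved`) and `TaylorGreenForceRegularTG_holds : TaylorGreenForceRegularTG` with
`Theses.KolmogorovPincer.TaylorGreenForceRegularTG_holds` (a DIFFERENT constant with the same short name), and — once route-qualified —
with `Theorems.TaylorGreenForceRegular.steadyMirrorGate_taylorGreenForceRegularTG` (whose module imports seven route files, the import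
this file avoids by design). The three binder types are therefore written QUALIFIED (`SteadyMirrorGate.TameMirrorLimitTG`,
`SteadyMirrorGate.SteadyWeakIsGlobalLerayHopf`, `Theses.SteadyMirrorGate.TaylorGreenForceRegularTG`) — the exact constants `closes`
binds — and the proofs reuse the landed declarations by name where the import is cheap; the names `<Decl>_holds` in THIS namespace are
the whole point of the file (`holdsProved`) and cannot be obtained by import. [folklore]
-/

-- every `Summit.AnomalousDissipation.AnomalousDissipation.…` name repeats the summit = problem segment (tree layout)
set_option linter.dupNamespace false

namespace Summit.AnomalousDissipation.AnomalousDissipation.Theses.SteadyMirrorGate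

open Summit.AnomalousDissipation.AnomalousDissipation.Theorems.TaylorGreenLoudGalerkinStates.Negative
  (isSmooth_tgForce isDivFree_tgForce hasZeroMean_tgForce)

/-- `TameMirrorLimitTG` (stmt-AnomalousDissipation-33833) holds — alias of the landed proof
`Theorems.steadyMirrorGate_tameMirrorLimitTG_holds` (Rellich passage inside the closed mirror class). [folklore] -/
theorem TameMirrorLimitTG_holds : SteadyMirrorGate.TameMirrorLimitTG :=
  Summit.AnomalousDissipation.AnomalousDissipation.Theorems.steadyMirrorGate_tameMirrorLimitTG_holds

/-- `SteadyWeakIsGlobalLerayHopf` (stmt-AnomalousDissipation-33834) holds — by definitional unfolding to the landed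
`Theorems.steadyWeakIsGlobalLerayHopf_proof` (body byte-identical with `MirrorVariety.SteadyWeakIsGlobalLerayHopf`,
stmt-AnomalousDissipation-2992; the same alias is recorded as `Theorems.steadyMirrorGate_steadyWeakIsGlobalLerayHopf_holds`
in `Theorems/SteadyWeakIsGlobalLerayHopfShared.lean`, whose module is not prefix-imported by the tribunal CLI). [folklore] -/
theorem SteadyWeakIsGlobalLerayHopf_holds : SteadyMirrorGate.SteadyWeakIsGlobalLerayHopf := by
  unfold SteadyMirrorGate.SteadyWeakIsGlobalLerayHopf
  exact Summit.AnomalousDissipation.AnomalousDissipation.Theorems.steadyWeakIsGlobalLerayHopf_proof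

/-- `TaylorGreenForceRegularTG` (stmt-AnomalousDissipation-24257) holds — the Taylor–Green force is smooth,
divergence free and mean zero (`isSmooth_tgForce`, `isDivFree_tgForce`, `hasZeroMean_tgForce`; the same three-line
proof as `Theorems.TaylorGreenForceRegular.steadyMirrorGate_taylorGreenForceRegularTG` in
`Theorems/CellRoutesTaylorGreenForceRegularTG.lean`, restated here to avoid importing seven route files). [folklore] -/
theorem TaylorGreenForceRegularTG_holds : Theses.SteadyMirrorGate.TaylorGreenForceRegularTG := by
  intro f hf
  subst hf
  exact ⟨isSmooth_tgForce, isDivFree_tgForce, hasZeroMean_tgForce⟩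

end Summit.AnomalousDissipation.AnomalousDissipation.Theses.SteadyMirrorGate
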